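import Literature.Geometry.ComplexHyperbolic.UnitBallKCentralWallCurveJets       -- ★ the one-sided jets `𝓘′(0⁺)`, `𝓘″(0⁺)` as integrals of `DΛ`, `D²Λ`
import Literature.Geometry.ComplexHyperbolic.UnitBallKCentralSecondOrder        -- ★ `vecMulVec_vecCons_real_mul_J_eq` (`N = A₀ + rA₁ + r²A₂`)
import Mathlib.Tactic.Module
import HarnessLib

/-!
# The wall-curve jets in terms of `DΘ`, `D²Θ`: the chain rule through the affine datum (ROAD A (A3), the cone integrands explicitly)

Topic `Geometry/ComplexHyperbolic`; namespace `Literature.Geometry.ComplexHyperbolic.BallModel`.  THEOREMS ONLY (no `def`, no instance, no notation, no axiom,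
no named fact, no `sorry`).  Cell `pub/hodgecm-mathlib`, ENGINE T1 (crux H413 = `stmt-HodgeConjecture-24833`); floor-1½, count-neutral, under row (S-d) ∕ «SdArch» ED. 3 node N1
(`stub_ArchCentralLimitU21`); author F0P3a-p05 (g13), 2026-09-01.

THE MATHEMATICS.  ★ `UnitBallKCentralWallCurveJets` gives the one-sided jets of the wall-curve sheet integral
`𝓘_Θ(t) = ∫ Λ(t, W, √(ε(t)+|W|²)) d⁴W`, `Λ(t, W, r) = Θ(u_t•1 + η_t•N(W₀,W₁,r))`, `u_t = ζe^{it}`, `η_t = iζe^{−it∕2}`, `ε(t) = 2 sin(3t∕2)`, as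
`𝓘′(0⁺) = ∫ DΛ(p_W)[v_W]`, `𝓘″(0⁺) = ∫ D²Λ(p_W)[v_W, v_W] + DΛ(p_W)[v′_W]` with `p_W = (0, W, |W|)`, `v_W = (1, 0, 3∕(2|W|))`, `v′_W = (0, 0, −9∕(4|W|³))`.
Here the derivatives of the COMPOSITE `Λ = Θ ∘ h` are unwound:
* §1 (generic) directional derivatives are derivatives along affine lines: `DΛ(p)[v] = (d∕ds)Λ(p + sv)|₀`, `D²Λ(p)[v,v] = (d∕ds)²Λ(p + sv)|₀` (`Λ ∈ C²`);
* §2 (generic) second-order chain rule along a curve: `(d∕ds)²Θ(γ(s))|₀ = D²Θ(γ₀)[γ′₀, γ′₀] + DΘ(γ₀)[γ″₀]`;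
* §3 the pieces of the wall datum: `u′ = iu`, `η′ = −(i∕2)η`, and `∂_r N(W₀,W₁,r) = A₁(W) + 2r•A₂` (★ `vecMulVec_vecCons_real_mul_J_eq`: `N = A₀ + rA₁ + r²A₂`,
  `A₁ = (a e₂* + e₂ a*)J`, `A₂ = e₂e₂*J`, `a = (W₀,W₁,0)`, `e₂ = (0,0,1)`);
* §4 the curve `γ(s) = h((0,W,r₀) + s(1,0,b)) = u_s•1 + η_s•N(W, r₀ + sb)` and its first two derivatives;
* §5 THE CONE INTEGRANDS: with `h₀(W) = ζ•1 + iζ•N(W,|W|)`, `V(W) = A₁(W) + 2|W|•A₂`, `b = 3∕(2|W|)`, `σ = −9∕(4|W|³)`,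
  **`𝓘′(0⁺) = ∫ DΘ(h₀)[X₁] d⁴W`,  `X₁ = iζ•1 + (ζ∕2)•N(W,|W|) + iζ•(b•V)`**,
  **`𝓘″(0⁺) = ∫ D²Θ(h₀)[X₁, X₁] + DΘ(h₀)[X₂] d⁴W`,  `X₂ = −ζ•1 − (iζ∕4)•N(W,|W|) + ζ•(b•V) + (2iζ)•(b•(b•A₂)) + iζ•(σ•V)`**
  — integrals over the null cone of `DΘ`, `D²Θ` against matrix fields homogeneous of degrees `0, 2` in `W` with the weights `|W|⁻¹` (in `b`) and `|W|⁻³` (in `σ`):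
  the input currency of ★ p06 `UnitBallRadialIntegrationByParts` (Euler ∕ vertex identities) for the value computation (A4-iii).
HONEST LABEL: HC_CM is proved only modulo the printed citations until rung 0 closes; this file is calculus in the ball model and pays nothing by itself.

## References
* [Rogawski1990] J. D. Rogawski, *Automorphic Representations of Unitary Groups in Three Variables*, Ann. of Math. Stud. 123 (1990), §8.4 pp. 126–127.
* [Rudin1980] W. Rudin, *Function Theory in the Unit Ball of ℂⁿ* (1980), §1.4.
* [Goldman1999] W. M. Goldman, *Complex Hyperbolic Geometry* (1999), §3.1.
-/

noncomputable section

open MeasureTheory MeasureTheory.Measure Set Filter Topology Metric Matrix Complex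
open scoped ENNReal Matrix.Norms.Operator

namespace Literature.Geometry.ComplexHyperbolic.BallModel

/-! ### §1 Directional derivatives along affine lines (generic) -/

section Line

variable {P : Type*} [NormedAddCommGroup P] [NormedSpace ℝ P] {G : Type*} [NormedAddCommGroup G] [NormedSpace ℝ G]

/-- The affine line `s ↦ p + s•v` has velocity `v`. [cite: Rudin1980, §1.4] -/
theorem hasDerivAt_affineLine (p v : P) (s : ℝ) : HasDerivAt (fun s : ℝ => p + s • v) v s := by
  simpa using ((hasDerivAt_id s).smul_const v).const_add p

/-- **`DΛ(p)[v] = (d∕ds) Λ(p + sv)|_{s=0}`.** [cite: Rudin1980, §1.4] -/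
theorem fderiv_apply_eq_deriv_affineLine (Λ : P → G) {p : P} (hΛ : DifferentiableAt ℝ Λ p) (v : P) :
    fderiv ℝ Λ p v = deriv (fun s : ℝ => Λ (p + s • v)) 0 :=
  (hΛ.hasFDerivAt.comp_hasDerivAt_of_eq 0 (hasDerivAt_affineLine p v 0) (by simp)).deriv.symm

/-- **`D²Λ(p)[v, v] = (d∕ds)² Λ(p + sv)|_{s=0}`** for `Λ` of class `C²`. [cite: Rudin1980, §1.4] -/
theorem fderiv_fderiv_apply_eq_iteratedDeriv_two_affineLine (Λ : P → G) (hΛ : ContDiff ℝ 2 Λ) (p v : P) :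
    fderiv ℝ (fderiv ℝ Λ) p v v = iteratedDeriv 2 (fun s : ℝ => Λ (p + s • v)) 0 := by
  rw [iteratedDeriv_succ, iteratedDeriv_one]
  have hd : deriv (fun s : ℝ => Λ (p + s • v)) = fun s : ℝ => fderiv ℝ Λ (p + s • v) v := by
    funext s
    exact ((hΛ.differentiable two_ne_zero).differentiableAt.hasFDerivAt.comp_hasDerivAt s (hasDerivAt_affineLine p v s)).deriv
  rw [hd]
  -- NB: `h1` unascribed (the codomain `P →L[ℝ] G` must keep its operator-norm topology)
  have h1 := hΛ.fderiv_right (m := 1) le_rfl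
  have h2 := (((h1.differentiable one_ne_zero) p).hasFDerivAt).comp_hasDerivAt_of_eq 0 (hasDerivAt_affineLine p v 0) (by simp)
  have h3 : HasDerivAt (fun s : ℝ => fderiv ℝ Λ (p + s • v) v) (fderiv ℝ (fderiv ℝ Λ) p v v + fderiv ℝ Λ (p + (0 : ℝ) • v) 0) 0 :=
    h2.clm_apply (hasDerivAt_const (0 : ℝ) v)
  rw [h3.deriv, map_zero, add_zero]

end Line

/-! ### §2 The second-order chain rule along a curve (generic) -/

section Curve

variable {E : Type*} [NormedAddCommGroup E] [NormedSpace ℝ E] {G : Type*} [NormedAddCommGroup G] [NormedSpace ℝ G]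

/-- `(d∕dσ) DΘ(γ(σ))[γ′(σ)] = D²Θ(γ)[γ′, γ′] + DΘ(γ)[γ″]` for `Θ ∈ C²`. [cite: Rudin1980, §1.4] -/
theorem hasDerivAt_fderiv_comp_apply_of_hasDerivAt (Θ : E → G) (hΘ : ContDiff ℝ 2 Θ) {γ γ' : ℝ → E} {γ''₀ : E} {s : ℝ}
    (hγ : HasDerivAt γ (γ' s) s) (hγ' : HasDerivAt γ' γ''₀ s) :
    HasDerivAt (fun σ : ℝ => fderiv ℝ Θ (γ σ) (γ' σ)) (fderiv ℝ (fderiv ℝ Θ) (γ s) (γ' s) (γ' s) + fderiv ℝ Θ (γ s) γ''₀) s := by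
  have h1 := hΘ.fderiv_right (m := 1) le_rfl
  have h2 := ((h1.differentiable one_ne_zero).differentiableAt.hasFDerivAt).comp_hasDerivAt s hγ
  exact h2.clm_apply hγ'

/-- `(d∕ds) Θ(γ(s))|₀ = DΘ(γ₀)[γ′₀]` for `Θ ∈ C¹`. [cite: Rudin1980, §1.4] -/
theorem deriv_comp_curve_eq (Θ : E → G) {n : WithTop ℕ∞} (hΘ : ContDiff ℝ n Θ) (hn : n ≠ 0) {γ : ℝ → E} {γ'₀ : E} (hγ : HasDerivAt γ γ'₀ 0) :
    deriv (fun s : ℝ => Θ (γ s)) 0 = fderiv ℝ Θ (γ 0) γ'₀ :=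
  (((hΘ.differentiable hn).differentiableAt.hasFDerivAt).comp_hasDerivAt 0 hγ).deriv

/-- **`(d∕ds)² Θ(γ(s))|₀ = D²Θ(γ₀)[γ′₀, γ′₀] + DΘ(γ₀)[γ″₀]`** for `Θ ∈ C²`. [cite: Rudin1980, §1.4] -/
theorem iteratedDeriv_two_comp_curve_eq (Θ : E → G) (hΘ : ContDiff ℝ 2 Θ) {γ γ' : ℝ → E} {γ''₀ : E}
    (hγ : ∀ s, HasDerivAt γ (γ' s) s) (hγ' : HasDerivAt γ' γ''₀ 0) :
    iteratedDeriv 2 (fun s : ℝ => Θ (γ s)) 0 = fderiv ℝ (fderiv ℝ Θ) (γ 0) (γ' 0) (γ' 0) + fderiv ℝ Θ (γ 0) γ''₀ := by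
  rw [iteratedDeriv_succ, iteratedDeriv_one]
  have hd : deriv (fun s : ℝ => Θ (γ s)) = fun s : ℝ => fderiv ℝ Θ (γ s) (γ' s) := by
    funext s
    exact (((hΘ.differentiable two_ne_zero).differentiableAt.hasFDerivAt).comp_hasDerivAt s (hγ s)).deriv
  rw [hd]
  exact (hasDerivAt_fderiv_comp_apply_of_hasDerivAt Θ hΘ (hγ 0) hγ').deriv

end Curve

/-! ### §3 The pieces of the wall datum: `u_s = ζe^{is}`, `η_s = iζe^{−is∕2}`, `r ↦ N(W₀, W₁, r)` -/

/-- `(d∕ds) u_s = i·u_s` for `u_s = ζe^{is}`. [cite: Rogawski1990, §8.4 pp. 126–127] -/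
theorem hasDerivAt_wallCurve_u (ζ : Circle) (s : ℝ) :
    HasDerivAt (fun s : ℝ => ((ζ * Circle.exp s : Circle) : ℂ)) (I * ((ζ * Circle.exp s : Circle) : ℂ)) s := by
  have h1 : HasDerivAt (fun y : ℝ => (y : ℂ) * I) (1 * I) s := ((hasDerivAt_id (s : ℂ)).comp_ofReal).mul_const I
  have h2 := ((Complex.hasDerivAt_exp _).comp s h1).const_mul (ζ : ℂ)
  have h3 : (fun s : ℝ => ((ζ * Circle.exp s : Circle) : ℂ)) = fun s : ℝ => (ζ : ℂ) * Complex.exp ((s : ℂ) * I) := by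
    funext s; rw [Circle.coe_mul, Circle.coe_exp]
  rw [h3]
  refine h2.congr_deriv ?_
  rw [Circle.coe_mul, Circle.coe_exp]; ring

/-- `(d∕ds) η_s = −(i∕2)·η_s` for `η_s = iζe^{−is∕2}`. [cite: Rogawski1990, §8.4 pp. 126–127] -/
theorem hasDerivAt_wallCurve_eta (ζ : Circle) (s : ℝ) :
    HasDerivAt (fun s : ℝ => I * (ζ : ℂ) * Complex.exp (-(s / 2 : ℝ) * I)) (-(I / 2) * (I * (ζ : ℂ) * Complex.exp (-(s / 2 : ℝ) * I))) s := by
  have h0 : HasDerivAt (fun y : ℝ => ((y / 2 : ℝ) : ℂ)) (((1 : ℝ) / 2 : ℝ) : ℂ) s := ((hasDerivAt_id s).div_const 2).ofReal_comp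
  have h1 : HasDerivAt (fun y : ℝ => -((y / 2 : ℝ) : ℂ) * I) (-(((1 : ℝ) / 2 : ℝ) : ℂ) * I) s := h0.neg.mul_const I
  have h2 := ((Complex.hasDerivAt_exp _).comp s h1).const_mul (I * (ζ : ℂ))
  refine h2.congr_deriv ?_
  push_cast; ring

/-- `(d∕dr) N(W₀,W₁,r) = A₁(W) + 2r•A₂`. [cite: Goldman1999, §3.1.1] -/
theorem hasDerivAt_vecMulVec_real (W : Fin 2 → ℂ) (r : ℝ) :
    HasDerivAt (fun r : ℝ => vecMulVec ![W 0, W 1, (r : ℂ)] (star ![W 0, W 1, (r : ℂ)]) * J)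
      ((vecMulVec ![W 0, W 1, 0] (star ![(0 : ℂ), 0, 1]) + vecMulVec ![(0 : ℂ), 0, 1] (star ![W 0, W 1, 0])) * J +
        (2 * r) • (vecMulVec ![(0 : ℂ), 0, 1] (star ![(0 : ℂ), 0, 1]) * J)) r := by
  have h1 : HasDerivAt (fun r : ℝ => r • ((vecMulVec ![W 0, W 1, 0] (star ![(0 : ℂ), 0, 1]) + vecMulVec ![(0 : ℂ), 0, 1] (star ![W 0, W 1, 0])) * J))
      ((1 : ℝ) • ((vecMulVec ![W 0, W 1, 0] (star ![(0 : ℂ), 0, 1]) + vecMulVec ![(0 : ℂ), 0, 1] (star ![W 0, W 1, 0])) * J)) r :=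
    (hasDerivAt_id r).smul_const _
  have h2 : HasDerivAt (fun r : ℝ => r ^ 2 • (vecMulVec ![(0 : ℂ), 0, 1] (star ![(0 : ℂ), 0, 1]) * J))
      (((2 : ℕ) * r ^ (2 - 1)) • (vecMulVec ![(0 : ℂ), 0, 1] (star ![(0 : ℂ), 0, 1]) * J)) r :=
    (hasDerivAt_pow 2 r).smul_const _
  have h3 := (h1.add h2).const_add (vecMulVec ![W 0, W 1, 0] (star ![W 0, W 1, 0]) * J)
  have h4 : HasDerivAt (fun r : ℝ => vecMulVec ![W 0, W 1, (r : ℂ)] (star ![W 0, W 1, (r : ℂ)]) * J)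
      ((1 : ℝ) • ((vecMulVec ![W 0, W 1, 0] (star ![(0 : ℂ), 0, 1]) + vecMulVec ![(0 : ℂ), 0, 1] (star ![W 0, W 1, 0])) * J) +
        ((2 : ℕ) * r ^ (2 - 1)) • (vecMulVec ![(0 : ℂ), 0, 1] (star ![(0 : ℂ), 0, 1]) * J)) r := by
    refine h3.congr_of_eventuallyEq (Filter.Eventually.of_forall fun r' => ?_)
    simp only [vecMulVec_vecCons_real_mul_J_eq, Pi.add_apply, add_assoc]
  refine h4.congr_deriv ?_
  simp only [one_smul, Nat.cast_ofNat, pow_one, Nat.add_one_sub_one]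

/-- `(d∕dr) (A₁(W) + 2r•A₂) = 2•A₂`. [cite: Goldman1999, §3.1.1] -/
theorem hasDerivAt_vecMulVec_real_deriv (W : Fin 2 → ℂ) (r : ℝ) :
    HasDerivAt (fun r : ℝ => (vecMulVec ![W 0, W 1, 0] (star ![(0 : ℂ), 0, 1]) + vecMulVec ![(0 : ℂ), 0, 1] (star ![W 0, W 1, 0])) * J +
        (2 * r) • (vecMulVec ![(0 : ℂ), 0, 1] (star ![(0 : ℂ), 0, 1]) * J))
      ((2 : ℝ) • (vecMulVec ![(0 : ℂ), 0, 1] (star ![(0 : ℂ), 0, 1]) * J)) r := by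
  have h1 : HasDerivAt (fun r : ℝ => (2 * r) • (vecMulVec ![(0 : ℂ), 0, 1] (star ![(0 : ℂ), 0, 1]) * J))
      ((2 * 1 : ℝ) • (vecMulVec ![(0 : ℂ), 0, 1] (star ![(0 : ℂ), 0, 1]) * J)) r :=
    ((hasDerivAt_id r).const_mul 2).smul_const _
  have h2 := h1.const_add ((vecMulVec ![W 0, W 1, 0] (star ![(0 : ℂ), 0, 1]) + vecMulVec ![(0 : ℂ), 0, 1] (star ![W 0, W 1, 0])) * J)
  refine h2.congr_deriv ?_
  rw [mul_one]

/-- Along `s ↦ r₀ + sb`: `(d∕ds) N(W₀,W₁,r₀+sb) = b•(A₁(W) + 2(r₀+sb)•A₂)`. [cite: Goldman1999, §3.1.1] -/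
theorem hasDerivAt_vecMulVec_affine (W : Fin 2 → ℂ) (r₀ b s : ℝ) :
    HasDerivAt (fun s : ℝ => vecMulVec ![W 0, W 1, ((r₀ + s * b : ℝ) : ℂ)] (star ![W 0, W 1, ((r₀ + s * b : ℝ) : ℂ)]) * J)
      (b • ((vecMulVec ![W 0, W 1, 0] (star ![(0 : ℂ), 0, 1]) + vecMulVec ![(0 : ℂ), 0, 1] (star ![W 0, W 1, 0])) * J +
        (2 * (r₀ + s * b)) • (vecMulVec ![(0 : ℂ), 0, 1] (star ![(0 : ℂ), 0, 1]) * J))) s := by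
  have hl : HasDerivAt (fun s : ℝ => r₀ + s * b) b s := by simpa using ((hasDerivAt_id s).mul_const b).const_add r₀
  exact (hasDerivAt_vecMulVec_real W (r₀ + s * b)).scomp s hl

/-- … and `(d∕ds) [b•(A₁(W) + 2(r₀+sb)•A₂)] = b•(b•(2•A₂))`. [cite: Goldman1999, §3.1.1] -/
theorem hasDerivAt_vecMulVec_affine_deriv (W : Fin 2 → ℂ) (r₀ b s : ℝ) :
    HasDerivAt (fun s : ℝ => b • ((vecMulVec ![W 0, W 1, 0] (star ![(0 : ℂ), 0, 1]) + vecMulVec ![(0 : ℂ), 0, 1] (star ![W 0, W 1, 0])) * J +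
        (2 * (r₀ + s * b)) • (vecMulVec ![(0 : ℂ), 0, 1] (star ![(0 : ℂ), 0, 1]) * J)))
      (b • (b • ((2 : ℝ) • (vecMulVec ![(0 : ℂ), 0, 1] (star ![(0 : ℂ), 0, 1]) * J)))) s := by
  have hl : HasDerivAt (fun s : ℝ => r₀ + s * b) b s := by simpa using ((hasDerivAt_id s).mul_const b).const_add r₀
  exact ((hasDerivAt_vecMulVec_real_deriv W (r₀ + s * b)).scomp s hl).const_smul b

/-! ### §4 The curve `γ(s) = u_s•1 + η_s•N(W₀, W₁, r₀ + sb)` and its first two derivatives -/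

/-- **FIRST DERIVATIVE OF THE LINE-RESTRICTED WALL ARGUMENT**: `γ′ = iu•1 + (η•(b•V) − (i∕2)η•N)`. [cite: Rogawski1990, §8.4 pp. 126–127] [cite: Goldman1999, §3.1.1] -/
theorem hasDerivAt_wallCurve_lineArg (ζ : Circle) (W : Fin 2 → ℂ) (r₀ b s : ℝ) :
    HasDerivAt (fun s : ℝ => ((ζ * Circle.exp s : Circle) : ℂ) • (1 : Matrix (Fin 3) (Fin 3) ℂ) +
        (I * (ζ : ℂ) * Complex.exp (-(s / 2 : ℝ) * I)) • (vecMulVec ![W 0, W 1, ((r₀ + s * b : ℝ) : ℂ)] (star ![W 0, W 1, ((r₀ + s * b : ℝ) : ℂ)]) * J))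
      ((I * ((ζ * Circle.exp s : Circle) : ℂ)) • (1 : Matrix (Fin 3) (Fin 3) ℂ) +
        ((I * (ζ : ℂ) * Complex.exp (-(s / 2 : ℝ) * I)) •
            (b • ((vecMulVec ![W 0, W 1, 0] (star ![(0 : ℂ), 0, 1]) + vecMulVec ![(0 : ℂ), 0, 1] (star ![W 0, W 1, 0])) * J +
              (2 * (r₀ + s * b)) • (vecMulVec ![(0 : ℂ), 0, 1] (star ![(0 : ℂ), 0, 1]) * J))) +
          (-(I / 2) * (I * (ζ : ℂ) * Complex.exp (-(s / 2 : ℝ) * I))) •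
            (vecMulVec ![W 0, W 1, ((r₀ + s * b : ℝ) : ℂ)] (star ![W 0, W 1, ((r₀ + s * b : ℝ) : ℂ)]) * J))) s :=
  ((hasDerivAt_wallCurve_u ζ s).smul_const (1 : Matrix (Fin 3) (Fin 3) ℂ)).add
    ((hasDerivAt_wallCurve_eta ζ s).smul (hasDerivAt_vecMulVec_affine W r₀ b s))

/-- **SECOND DERIVATIVE OF THE LINE-RESTRICTED WALL ARGUMENT** (raw product-rule form). [cite: Rogawski1990, §8.4 pp. 126–127] [cite: Goldman1999, §3.1.1] -/
theorem hasDerivAt_wallCurve_lineArg_deriv (ζ : Circle) (W : Fin 2 → ℂ) (r₀ b s : ℝ) :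
    HasDerivAt (fun s : ℝ => (I * ((ζ * Circle.exp s : Circle) : ℂ)) • (1 : Matrix (Fin 3) (Fin 3) ℂ) +
        ((I * (ζ : ℂ) * Complex.exp (-(s / 2 : ℝ) * I)) •
            (b • ((vecMulVec ![W 0, W 1, 0] (star ![(0 : ℂ), 0, 1]) + vecMulVec ![(0 : ℂ), 0, 1] (star ![W 0, W 1, 0])) * J +
              (2 * (r₀ + s * b)) • (vecMulVec ![(0 : ℂ), 0, 1] (star ![(0 : ℂ), 0, 1]) * J))) +
          (-(I / 2) * (I * (ζ : ℂ) * Complex.exp (-(s / 2 : ℝ) * I))) •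
            (vecMulVec ![W 0, W 1, ((r₀ + s * b : ℝ) : ℂ)] (star ![W 0, W 1, ((r₀ + s * b : ℝ) : ℂ)]) * J)))
      ((I * (I * ((ζ * Circle.exp s : Circle) : ℂ))) • (1 : Matrix (Fin 3) (Fin 3) ℂ) +
        (((I * (ζ : ℂ) * Complex.exp (-(s / 2 : ℝ) * I)) • (b • (b • ((2 : ℝ) • (vecMulVec ![(0 : ℂ), 0, 1] (star ![(0 : ℂ), 0, 1]) * J)))) +
            (-(I / 2) * (I * (ζ : ℂ) * Complex.exp (-(s / 2 : ℝ) * I))) •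
              (b • ((vecMulVec ![W 0, W 1, 0] (star ![(0 : ℂ), 0, 1]) + vecMulVec ![(0 : ℂ), 0, 1] (star ![W 0, W 1, 0])) * J +
                (2 * (r₀ + s * b)) • (vecMulVec ![(0 : ℂ), 0, 1] (star ![(0 : ℂ), 0, 1]) * J)))) +
          ((-(I / 2) * (I * (ζ : ℂ) * Complex.exp (-(s / 2 : ℝ) * I))) •
              (b • ((vecMulVec ![W 0, W 1, 0] (star ![(0 : ℂ), 0, 1]) + vecMulVec ![(0 : ℂ), 0, 1] (star ![W 0, W 1, 0])) * J +
                (2 * (r₀ + s * b)) • (vecMulVec ![(0 : ℂ), 0, 1] (star ![(0 : ℂ), 0, 1]) * J))) +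
            (-(I / 2) * (-(I / 2) * (I * (ζ : ℂ) * Complex.exp (-(s / 2 : ℝ) * I)))) •
              (vecMulVec ![W 0, W 1, ((r₀ + s * b : ℝ) : ℂ)] (star ![W 0, W 1, ((r₀ + s * b : ℝ) : ℂ)]) * J)))) s :=
  (((hasDerivAt_wallCurve_u ζ s).const_mul I).smul_const (1 : Matrix (Fin 3) (Fin 3) ℂ)).add
    (((hasDerivAt_wallCurve_eta ζ s).smul (hasDerivAt_vecMulVec_affine_deriv W r₀ b s)).add
      (((hasDerivAt_wallCurve_eta ζ s).const_mul (-(I / 2))).smul (hasDerivAt_vecMulVec_affine W r₀ b s)))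

/-- The pure sheet-radius line `s ↦ ζ•1 + iζ•N(W₀,W₁,r₀+sb)` has derivative `iζ•(b•V)`. [cite: Goldman1999, §3.1.1] -/
theorem hasDerivAt_wallCurve_radiusLineArg (ζ : Circle) (W : Fin 2 → ℂ) (r₀ b s : ℝ) :
    HasDerivAt (fun s : ℝ => (ζ : ℂ) • (1 : Matrix (Fin 3) (Fin 3) ℂ) +
        (I * (ζ : ℂ)) • (vecMulVec ![W 0, W 1, ((r₀ + s * b : ℝ) : ℂ)] (star ![W 0, W 1, ((r₀ + s * b : ℝ) : ℂ)]) * J))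
      ((I * (ζ : ℂ)) • (b • ((vecMulVec ![W 0, W 1, 0] (star ![(0 : ℂ), 0, 1]) + vecMulVec ![(0 : ℂ), 0, 1] (star ![W 0, W 1, 0])) * J +
        (2 * (r₀ + s * b)) • (vecMulVec ![(0 : ℂ), 0, 1] (star ![(0 : ℂ), 0, 1]) * J)))) s :=
  ((hasDerivAt_vecMulVec_affine W r₀ b s).const_smul (I * (ζ : ℂ))).const_add _

/-! ### §5 The cone integrands of `𝓘′(0⁺)` and `𝓘″(0⁺)` in terms of `DΘ`, `D²Θ` -/

section Datum

variable {G : Type*} [NormedAddCommGroup G] [NormedSpace ℝ G]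

/-- **POINTWISE, FIRST ORDER**: `DΛ(0,W,r₀)[(1,0,b)] = DΘ(h₀)[X₁]`, `h₀ = ζ•1 + iζ•N(W,r₀)`, `X₁ = iζ•1 + (ζ∕2)•N(W,r₀) + iζ•(b•(A₁(W) + 2r₀•A₂))`.
[cite: Rogawski1990, §8.4 pp. 126–127] [cite: Goldman1999, §3.1.1] -/
theorem fderiv_wallCurve_datum_apply (Θ : Matrix (Fin 3) (Fin 3) ℂ → G) (hΘ : ContDiff ℝ 2 Θ) (ζ : Circle) (W : Fin 2 → ℂ) (r₀ b : ℝ) :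
    fderiv ℝ (fun p : ℝ × (Fin 2 → ℂ) × ℝ => Θ (((ζ * Circle.exp p.1 : Circle) : ℂ) • (1 : Matrix (Fin 3) (Fin 3) ℂ) +
        (I * (ζ : ℂ) * Complex.exp (-(p.1 / 2 : ℝ) * I)) • (vecMulVec ![p.2.1 0, p.2.1 1, (p.2.2 : ℂ)] (star ![p.2.1 0, p.2.1 1, (p.2.2 : ℂ)]) * J)))
        (0, W, r₀) ((1 : ℝ), (0 : Fin 2 → ℂ), b) =
      fderiv ℝ Θ ((ζ : ℂ) • (1 : Matrix (Fin 3) (Fin 3) ℂ) + (I * (ζ : ℂ)) • (vecMulVec ![W 0, W 1, (r₀ : ℂ)] (star ![W 0, W 1, (r₀ : ℂ)]) * J))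
        ((I * (ζ : ℂ)) • (1 : Matrix (Fin 3) (Fin 3) ℂ) + ((ζ : ℂ) / 2) • (vecMulVec ![W 0, W 1, (r₀ : ℂ)] (star ![W 0, W 1, (r₀ : ℂ)]) * J) +
          (I * (ζ : ℂ)) • (b • ((vecMulVec ![W 0, W 1, 0] (star ![(0 : ℂ), 0, 1]) + vecMulVec ![(0 : ℂ), 0, 1] (star ![W 0, W 1, 0])) * J +
            (2 * r₀) • (vecMulVec ![(0 : ℂ), 0, 1] (star ![(0 : ℂ), 0, 1]) * J)))) := by
  have hΛ := contDiff_wallCurve_datum Θ hΘ ζ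
  rw [fderiv_apply_eq_deriv_affineLine _ ((hΛ.differentiable two_ne_zero) _)]
  have hline : (fun s : ℝ => (fun p : ℝ × (Fin 2 → ℂ) × ℝ => Θ (((ζ * Circle.exp p.1 : Circle) : ℂ) • (1 : Matrix (Fin 3) (Fin 3) ℂ) +
        (I * (ζ : ℂ) * Complex.exp (-(p.1 / 2 : ℝ) * I)) • (vecMulVec ![p.2.1 0, p.2.1 1, (p.2.2 : ℂ)] (star ![p.2.1 0, p.2.1 1, (p.2.2 : ℂ)]) * J)))
        (((0 : ℝ), W, r₀) + s • ((1 : ℝ), (0 : Fin 2 → ℂ), b))) =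
      fun s : ℝ => Θ (((ζ * Circle.exp s : Circle) : ℂ) • (1 : Matrix (Fin 3) (Fin 3) ℂ) +
        (I * (ζ : ℂ) * Complex.exp (-(s / 2 : ℝ) * I)) • (vecMulVec ![W 0, W 1, ((r₀ + s * b : ℝ) : ℂ)] (star ![W 0, W 1, ((r₀ + s * b : ℝ) : ℂ)]) * J)) := by
    funext s
    simp only [Prod.smul_mk, Prod.mk_add_mk, smul_eq_mul, mul_one, zero_add, smul_zero, add_zero]
  rw [hline, deriv_comp_curve_eq Θ hΘ two_ne_zero (hasDerivAt_wallCurve_lineArg ζ W r₀ b 0)]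
  have hI : -(I / 2) * (I * (ζ : ℂ)) = (ζ : ℂ) / 2 := by linear_combination (-(ζ : ℂ) / 2) * Complex.I_sq
  simp only [Circle.exp_zero, mul_one, zero_div, Complex.ofReal_zero, neg_zero, zero_mul, Complex.exp_zero, add_zero, hI]
  congr 1
  module

/-- **POINTWISE, SECOND ORDER**: `D²Λ(0,W,r₀)[(1,0,b),(1,0,b)] + DΛ(0,W,r₀)[(0,0,σ)] = D²Θ(h₀)[X₁, X₁] + DΘ(h₀)[X₂]` with
`X₂ = −ζ•1 − (iζ∕4)•N(W,r₀) + ζ•(b•V) + (2iζ)•(b•(b•A₂)) + iζ•(σ•V)`, `V = A₁(W) + 2r₀•A₂`. [cite: Rogawski1990, §8.4 pp. 126–127] [cite: Goldman1999, §3.1.1] -/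
theorem fderiv_fderiv_wallCurve_datum_apply (Θ : Matrix (Fin 3) (Fin 3) ℂ → G) (hΘ : ContDiff ℝ 2 Θ) (ζ : Circle) (W : Fin 2 → ℂ) (r₀ b σ : ℝ) :
    fderiv ℝ (fderiv ℝ (fun p : ℝ × (Fin 2 → ℂ) × ℝ => Θ (((ζ * Circle.exp p.1 : Circle) : ℂ) • (1 : Matrix (Fin 3) (Fin 3) ℂ) +
          (I * (ζ : ℂ) * Complex.exp (-(p.1 / 2 : ℝ) * I)) • (vecMulVec ![p.2.1 0, p.2.1 1, (p.2.2 : ℂ)] (star ![p.2.1 0, p.2.1 1, (p.2.2 : ℂ)]) * J))))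
          (0, W, r₀) ((1 : ℝ), (0 : Fin 2 → ℂ), b) ((1 : ℝ), (0 : Fin 2 → ℂ), b) +
        fderiv ℝ (fun p : ℝ × (Fin 2 → ℂ) × ℝ => Θ (((ζ * Circle.exp p.1 : Circle) : ℂ) • (1 : Matrix (Fin 3) (Fin 3) ℂ) +
          (I * (ζ : ℂ) * Complex.exp (-(p.1 / 2 : ℝ) * I)) • (vecMulVec ![p.2.1 0, p.2.1 1, (p.2.2 : ℂ)] (star ![p.2.1 0, p.2.1 1, (p.2.2 : ℂ)]) * J)))
          (0, W, r₀) ((0 : ℝ), (0 : Fin 2 → ℂ), σ) =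
      fderiv ℝ (fderiv ℝ Θ) ((ζ : ℂ) • (1 : Matrix (Fin 3) (Fin 3) ℂ) + (I * (ζ : ℂ)) • (vecMulVec ![W 0, W 1, (r₀ : ℂ)] (star ![W 0, W 1, (r₀ : ℂ)]) * J))
          ((I * (ζ : ℂ)) • (1 : Matrix (Fin 3) (Fin 3) ℂ) + ((ζ : ℂ) / 2) • (vecMulVec ![W 0, W 1, (r₀ : ℂ)] (star ![W 0, W 1, (r₀ : ℂ)]) * J) +
            (I * (ζ : ℂ)) • (b • ((vecMulVec ![W 0, W 1, 0] (star ![(0 : ℂ), 0, 1]) + vecMulVec ![(0 : ℂ), 0, 1] (star ![W 0, W 1, 0])) * J +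
              (2 * r₀) • (vecMulVec ![(0 : ℂ), 0, 1] (star ![(0 : ℂ), 0, 1]) * J))))
          ((I * (ζ : ℂ)) • (1 : Matrix (Fin 3) (Fin 3) ℂ) + ((ζ : ℂ) / 2) • (vecMulVec ![W 0, W 1, (r₀ : ℂ)] (star ![W 0, W 1, (r₀ : ℂ)]) * J) +
            (I * (ζ : ℂ)) • (b • ((vecMulVec ![W 0, W 1, 0] (star ![(0 : ℂ), 0, 1]) + vecMulVec ![(0 : ℂ), 0, 1] (star ![W 0, W 1, 0])) * J +
              (2 * r₀) • (vecMulVec ![(0 : ℂ), 0, 1] (star ![(0 : ℂ), 0, 1]) * J)))) +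
        fderiv ℝ Θ ((ζ : ℂ) • (1 : Matrix (Fin 3) (Fin 3) ℂ) + (I * (ζ : ℂ)) • (vecMulVec ![W 0, W 1, (r₀ : ℂ)] (star ![W 0, W 1, (r₀ : ℂ)]) * J))
          (-((ζ : ℂ) • (1 : Matrix (Fin 3) (Fin 3) ℂ)) + (-(I * (ζ : ℂ)) / 4) • (vecMulVec ![W 0, W 1, (r₀ : ℂ)] (star ![W 0, W 1, (r₀ : ℂ)]) * J) +
            (ζ : ℂ) • (b • ((vecMulVec ![W 0, W 1, 0] (star ![(0 : ℂ), 0, 1]) + vecMulVec ![(0 : ℂ), 0, 1] (star ![W 0, W 1, 0])) * J +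
              (2 * r₀) • (vecMulVec ![(0 : ℂ), 0, 1] (star ![(0 : ℂ), 0, 1]) * J))) +
            (2 * I * (ζ : ℂ)) • (b • (b • (vecMulVec ![(0 : ℂ), 0, 1] (star ![(0 : ℂ), 0, 1]) * J))) +
            (I * (ζ : ℂ)) • (σ • ((vecMulVec ![W 0, W 1, 0] (star ![(0 : ℂ), 0, 1]) + vecMulVec ![(0 : ℂ), 0, 1] (star ![W 0, W 1, 0])) * J +
              (2 * r₀) • (vecMulVec ![(0 : ℂ), 0, 1] (star ![(0 : ℂ), 0, 1]) * J)))) := by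
  have hΛ := contDiff_wallCurve_datum Θ hΘ ζ
  rw [fderiv_fderiv_apply_eq_iteratedDeriv_two_affineLine _ hΛ, fderiv_apply_eq_deriv_affineLine _ ((hΛ.differentiable two_ne_zero) _)]
  have hline : (fun s : ℝ => (fun p : ℝ × (Fin 2 → ℂ) × ℝ => Θ (((ζ * Circle.exp p.1 : Circle) : ℂ) • (1 : Matrix (Fin 3) (Fin 3) ℂ) +
        (I * (ζ : ℂ) * Complex.exp (-(p.1 / 2 : ℝ) * I)) • (vecMulVec ![p.2.1 0, p.2.1 1, (p.2.2 : ℂ)] (star ![p.2.1 0, p.2.1 1, (p.2.2 : ℂ)]) * J)))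
        (((0 : ℝ), W, r₀) + s • ((1 : ℝ), (0 : Fin 2 → ℂ), b))) =
      fun s : ℝ => Θ (((ζ * Circle.exp s : Circle) : ℂ) • (1 : Matrix (Fin 3) (Fin 3) ℂ) +
        (I * (ζ : ℂ) * Complex.exp (-(s / 2 : ℝ) * I)) • (vecMulVec ![W 0, W 1, ((r₀ + s * b : ℝ) : ℂ)] (star ![W 0, W 1, ((r₀ + s * b : ℝ) : ℂ)]) * J)) := by
    funext s
    simp only [Prod.smul_mk, Prod.mk_add_mk, smul_eq_mul, mul_one, zero_add, smul_zero, add_zero]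
  have hline' : (fun s : ℝ => (fun p : ℝ × (Fin 2 → ℂ) × ℝ => Θ (((ζ * Circle.exp p.1 : Circle) : ℂ) • (1 : Matrix (Fin 3) (Fin 3) ℂ) +
        (I * (ζ : ℂ) * Complex.exp (-(p.1 / 2 : ℝ) * I)) • (vecMulVec ![p.2.1 0, p.2.1 1, (p.2.2 : ℂ)] (star ![p.2.1 0, p.2.1 1, (p.2.2 : ℂ)]) * J)))
        (((0 : ℝ), W, r₀) + s • ((0 : ℝ), (0 : Fin 2 → ℂ), σ))) =
      fun s : ℝ => Θ ((ζ : ℂ) • (1 : Matrix (Fin 3) (Fin 3) ℂ) +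
        (I * (ζ : ℂ)) • (vecMulVec ![W 0, W 1, ((r₀ + s * σ : ℝ) : ℂ)] (star ![W 0, W 1, ((r₀ + s * σ : ℝ) : ℂ)]) * J)) := by
    funext s
    simp only [Prod.smul_mk, Prod.mk_add_mk, smul_eq_mul, mul_zero, smul_zero, add_zero, Circle.exp_zero, mul_one, zero_div,
      Complex.ofReal_zero, neg_zero, zero_mul, Complex.exp_zero]
  rw [hline, hline', iteratedDeriv_two_comp_curve_eq Θ hΘ (fun s => hasDerivAt_wallCurve_lineArg ζ W r₀ b s) (hasDerivAt_wallCurve_lineArg_deriv ζ W r₀ b 0),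
    deriv_comp_curve_eq Θ hΘ two_ne_zero (hasDerivAt_wallCurve_radiusLineArg ζ W r₀ σ 0)]
  have hI : -(I / 2) * (I * (ζ : ℂ)) = (ζ : ℂ) / 2 := by linear_combination (-(ζ : ℂ) / 2) * Complex.I_sq
  have hI2 : I * (I * (ζ : ℂ)) = -(ζ : ℂ) := by linear_combination (ζ : ℂ) * Complex.I_sq
  have hI3 : -(I / 2) * ((ζ : ℂ) / 2) = -(I * (ζ : ℂ)) / 4 := by ring
  simp only [Circle.exp_zero, mul_one, zero_div, Complex.ofReal_zero, neg_zero, zero_mul, Complex.exp_zero, add_zero, hI, hI2, hI3]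
  rw [add_assoc, ← map_add]
  have key : ∀ (L : Matrix (Fin 3) (Fin 3) ℂ →L[ℝ] Matrix (Fin 3) (Fin 3) ℂ →L[ℝ] G) (L₁ : Matrix (Fin 3) (Fin 3) ℂ →L[ℝ] G) (X Y X' Y' : Matrix (Fin 3) (Fin 3) ℂ),
      X = X' → Y = Y' → L X X + L₁ Y = L X' X' + L₁ Y' := by
    rintro _ _ _ _ _ _ rfl rfl; rfl
  apply key <;> module

/-- **`𝓘′(0⁺)` AS A CONE INTEGRAL OF `DΘ`**: `derivWithin 𝓘_Θ (Icc 0 δ) 0 = ∫ DΘ(h₀(W))[X₁(W)] d⁴W` with `h₀(W) = ζ•1 + iζ•N(W,|W|)`,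
`X₁(W) = iζ•1 + (ζ∕2)•N(W,|W|) + iζ•((3∕(2|W|))•(A₁(W) + 2|W|•A₂))`, `|W| = √(nsq W)`. [cite: Rogawski1990, §8.4 pp. 126–127] [cite: Rudin1980, §1.4] -/
theorem derivWithin_wallCurve_sheetIntegral_zero_eq (Θ : Matrix (Fin 3) (Fin 3) ℂ → G) (hΘ : ContDiff ℝ 2 Θ) (hΘc : HasCompactSupport Θ) (ζ : Circle)
    {δ : ℝ} (hδ : 0 < δ) (hδ' : δ < 2 * Real.pi / 3) :
    derivWithin (fun t : ℝ => ∫ W : Fin 2 → ℂ, Θ (((ζ * Circle.exp t : Circle) : ℂ) • (1 : Matrix (Fin 3) (Fin 3) ℂ) +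
      (I * (ζ : ℂ) * Complex.exp (-(t / 2 : ℝ) * I)) •
        (vecMulVec ![W 0, W 1, (Real.sqrt (2 * Real.sin (3 * t / 2) + nsq W) : ℂ)] (star ![W 0, W 1, (Real.sqrt (2 * Real.sin (3 * t / 2) + nsq W) : ℂ)]) * J))) (Icc 0 δ) 0 =
      ∫ W : Fin 2 → ℂ, fderiv ℝ Θ ((ζ : ℂ) • (1 : Matrix (Fin 3) (Fin 3) ℂ) +
          (I * (ζ : ℂ)) • (vecMulVec ![W 0, W 1, (Real.sqrt (nsq W) : ℂ)] (star ![W 0, W 1, (Real.sqrt (nsq W) : ℂ)]) * J))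
        ((I * (ζ : ℂ)) • (1 : Matrix (Fin 3) (Fin 3) ℂ) +
          ((ζ : ℂ) / 2) • (vecMulVec ![W 0, W 1, (Real.sqrt (nsq W) : ℂ)] (star ![W 0, W 1, (Real.sqrt (nsq W) : ℂ)]) * J) +
          (I * (ζ : ℂ)) • ((3 * (2 * Real.sqrt (nsq W))⁻¹) • ((vecMulVec ![W 0, W 1, 0] (star ![(0 : ℂ), 0, 1]) + vecMulVec ![(0 : ℂ), 0, 1] (star ![W 0, W 1, 0])) * J +
            (2 * Real.sqrt (nsq W)) • (vecMulVec ![(0 : ℂ), 0, 1] (star ![(0 : ℂ), 0, 1]) * J)))) := by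
  rw [derivWithin_wallCurve_sheetIntegral_zero Θ hΘ hΘc ζ hδ hδ']
  congr 1; ext W
  exact fderiv_wallCurve_datum_apply Θ hΘ ζ W _ _

/-- **`𝓘″(0⁺)` AS A CONE INTEGRAL OF `D²Θ`, `DΘ`**: `iteratedDerivWithin 2 𝓘_Θ (Icc 0 δ) 0 = ∫ D²Θ(h₀(W))[X₁(W), X₁(W)] + DΘ(h₀(W))[X₂(W)] d⁴W` with
`X₂(W) = −ζ•1 − (iζ∕4)•N(W,|W|) + ζ•(b•V) + (2iζ)•(b•(b•A₂)) + iζ•(σ•V)`, `V = A₁(W) + 2|W|•A₂`, `b = 3∕(2|W|)`, `σ = −9∕(4|W|³)`.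
[cite: Rogawski1990, §8.4 pp. 126–127] [cite: Rudin1980, §1.4] -/
theorem iteratedDerivWithin_two_wallCurve_sheetIntegral_zero_eq (Θ : Matrix (Fin 3) (Fin 3) ℂ → G) (hΘ : ContDiff ℝ 2 Θ) (hΘc : HasCompactSupport Θ)
    (ζ : Circle) {δ : ℝ} (hδ : 0 < δ) (hδ' : δ < 2 * Real.pi / 3) :
    iteratedDerivWithin 2 (fun t : ℝ => ∫ W : Fin 2 → ℂ, Θ (((ζ * Circle.exp t : Circle) : ℂ) • (1 : Matrix (Fin 3) (Fin 3) ℂ) +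
      (I * (ζ : ℂ) * Complex.exp (-(t / 2 : ℝ) * I)) •
        (vecMulVec ![W 0, W 1, (Real.sqrt (2 * Real.sin (3 * t / 2) + nsq W) : ℂ)] (star ![W 0, W 1, (Real.sqrt (2 * Real.sin (3 * t / 2) + nsq W) : ℂ)]) * J))) (Icc 0 δ) 0 =
      ∫ W : Fin 2 → ℂ,
        (fderiv ℝ (fderiv ℝ Θ) ((ζ : ℂ) • (1 : Matrix (Fin 3) (Fin 3) ℂ) +
            (I * (ζ : ℂ)) • (vecMulVec ![W 0, W 1, (Real.sqrt (nsq W) : ℂ)] (star ![W 0, W 1, (Real.sqrt (nsq W) : ℂ)]) * J))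
            ((I * (ζ : ℂ)) • (1 : Matrix (Fin 3) (Fin 3) ℂ) +
              ((ζ : ℂ) / 2) • (vecMulVec ![W 0, W 1, (Real.sqrt (nsq W) : ℂ)] (star ![W 0, W 1, (Real.sqrt (nsq W) : ℂ)]) * J) +
              (I * (ζ : ℂ)) • ((3 * (2 * Real.sqrt (nsq W))⁻¹) • ((vecMulVec ![W 0, W 1, 0] (star ![(0 : ℂ), 0, 1]) + vecMulVec ![(0 : ℂ), 0, 1] (star ![W 0, W 1, 0])) * J +
                (2 * Real.sqrt (nsq W)) • (vecMulVec ![(0 : ℂ), 0, 1] (star ![(0 : ℂ), 0, 1]) * J))))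
            ((I * (ζ : ℂ)) • (1 : Matrix (Fin 3) (Fin 3) ℂ) +
              ((ζ : ℂ) / 2) • (vecMulVec ![W 0, W 1, (Real.sqrt (nsq W) : ℂ)] (star ![W 0, W 1, (Real.sqrt (nsq W) : ℂ)]) * J) +
              (I * (ζ : ℂ)) • ((3 * (2 * Real.sqrt (nsq W))⁻¹) • ((vecMulVec ![W 0, W 1, 0] (star ![(0 : ℂ), 0, 1]) + vecMulVec ![(0 : ℂ), 0, 1] (star ![W 0, W 1, 0])) * J +
                (2 * Real.sqrt (nsq W)) • (vecMulVec ![(0 : ℂ), 0, 1] (star ![(0 : ℂ), 0, 1]) * J)))) +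
          fderiv ℝ Θ ((ζ : ℂ) • (1 : Matrix (Fin 3) (Fin 3) ℂ) +
            (I * (ζ : ℂ)) • (vecMulVec ![W 0, W 1, (Real.sqrt (nsq W) : ℂ)] (star ![W 0, W 1, (Real.sqrt (nsq W) : ℂ)]) * J))
            (-((ζ : ℂ) • (1 : Matrix (Fin 3) (Fin 3) ℂ)) +
              (-(I * (ζ : ℂ)) / 4) • (vecMulVec ![W 0, W 1, (Real.sqrt (nsq W) : ℂ)] (star ![W 0, W 1, (Real.sqrt (nsq W) : ℂ)]) * J) +
              (ζ : ℂ) • ((3 * (2 * Real.sqrt (nsq W))⁻¹) • ((vecMulVec ![W 0, W 1, 0] (star ![(0 : ℂ), 0, 1]) + vecMulVec ![(0 : ℂ), 0, 1] (star ![W 0, W 1, 0])) * J +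
                (2 * Real.sqrt (nsq W)) • (vecMulVec ![(0 : ℂ), 0, 1] (star ![(0 : ℂ), 0, 1]) * J))) +
              (2 * I * (ζ : ℂ)) • ((3 * (2 * Real.sqrt (nsq W))⁻¹) • ((3 * (2 * Real.sqrt (nsq W))⁻¹) • (vecMulVec ![(0 : ℂ), 0, 1] (star ![(0 : ℂ), 0, 1]) * J))) +
              (I * (ζ : ℂ)) • ((-(9 * (4 * Real.sqrt (nsq W) ^ 3)⁻¹)) • ((vecMulVec ![W 0, W 1, 0] (star ![(0 : ℂ), 0, 1]) + vecMulVec ![(0 : ℂ), 0, 1] (star ![W 0, W 1, 0])) * J +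
                (2 * Real.sqrt (nsq W)) • (vecMulVec ![(0 : ℂ), 0, 1] (star ![(0 : ℂ), 0, 1]) * J))))) := by
  rw [iteratedDerivWithin_two_wallCurve_sheetIntegral_zero Θ hΘ hΘc ζ hδ hδ']
  congr 1; ext W
  exact fderiv_fderiv_wallCurve_datum_apply Θ hΘ ζ W _ _ _

end Datum

end Literature.Geometry.ComplexHyperbolic.BallModel

end
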